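import Literature.AlgebraicGeometry.HodgeTheory.AbelianVarietySubvarietiesFiniteIffMultiplicityFree
import Literature.AlgebraicGeometry.Motives.AbelianVarietyIsogenyCancellation
import HarnessLib

/-!
# Which abelian varieties have finitely many abelian subvarieties: exactly those isogenous to a product of pairwise
# non-isogenous simple abelian varieties (then there are `2^r` of them; a simple one has `2`; `B × B'` with `B ∼ B'` has
# infinitely many) (Mumford §19 Cor. 1–2; Zarhin 2008 Thm. 3.2 = Lenstra–Oort–Zarhin 1996)

Layer `Literature/AlgebraicGeometry/HodgeTheory`; theorems only (no `def`, no instance, no named fact; net debt 0).  This file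
states the results of `HodgeTheory/AbelianVarietyMultiplicityFreeSubvarieties` and
`…SubvarietiesFiniteIffMultiplicityFree` WITHOUT a chosen system of isotypic components: the hypotheses are isogeny
decompositions `X ∼ ⨁_q B_q` ∕ `X ∼ ⨁_q B_q^{m_q}`, realised inside `X` by
`Motives/AbelianVarietyBiproductIsogenies.exists_isClosedImmersion_isIsogeny_biproduct_desc` (any field); the
characterisation (§2) is over a PERFECT field, where every `X` has isotypic components
(`HodgeTheory/AbelianVarietyIsotypicComponents`).  «Abelian subvariety» is recorded by its underlying closed subset
`range j ⊆ X` (abelian subvarieties with the same closed subset are isomorphic over `X`,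
`Motives/AbelianVarietySubvarietyFactorisationAnyField.exists_iso_of_range_eq`).

THE PRINT.  Mumford, *Abelian Varieties* §19 Cor. 1 of Thm. 1 (p. 173: `X ∼ ∏ X_i^{n_i}`, `X_i` simple pairwise
non-isogenous, `n_i` unique) and Cor. 2 (p. 174); Zarhin, *Homomorphisms of abelian varieties over finite fields* (2008)
Thm. 3.2 (p. 7; Lenstra–Oort–Zarhin 1996): the set of abelian subvarieties is finite up to `Aut(X)`.  The absolute
statement proved here: FINITELY MANY abelian subvarieties ⟺ all `n_i = 1` (then they are the `2^r` partial products);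
`n_i ≥ 2` produces the infinitely many graphs in `X_i × X_i`.

Results (namespace `Literature.AlgebraicGeometry.HodgeTheory.AbelianVariety`):
* §1 (any field ∕ perfect field as marked) **`infinite_setOf_range_subvariety_of_isIsogenous_biproduct_powers`** (any
  field: `X ∼ ⨁_q B_q^{m_q}` with some `m_q ≥ 2`, `0 < dim B_q` ⟹ infinitely many),
  `infinite_setOf_range_subvariety_biprod_of_isIsogenous` (any field: `B ⊞ B'` with `B ∼ B'`, `0 < dim B`),
  **`finite_setOf_range_subvariety_of_isIsogenous_biproduct_simple`** (perfect field: `X ∼ ⨁_q B_q`, `B_q` simple of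
  positive dimension pairwise non-isogenous ⟹ finitely many), `natCard_setOf_range_subvariety_of_isIsogenous_biproduct_simple`
  (`= 2^{#Q}`), `natCard_setOf_range_subvariety_of_isSimple` (a simple `X` of positive dimension has exactly `2`);
* §2 (perfect field) **`finite_setOf_range_subvariety_iff_exists_isIsogenous_biproduct_simple`** (finitely many abelian
  subvarieties ⟺ `X ∼ ⨁_{q < r} B_q` with the `B_q` simple of positive dimension and pairwise non-isogenous).

## References
* [Zarhin2008HomomorphismsFiniteFields] Yu. G. Zarhin, *Homomorphisms of abelian varieties over finite fields* (2008)
  (arXiv:0711.1615), Thm. 3.2 and §5 (pp. 7, 9), reporting Lenstra–Oort–Zarhin, J. Algebra 180 (1996).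
* [MumfordAV1970] D. Mumford, *Abelian Varieties* (1970), §19 Thm. 1, Cor. 1–2, Thm. 3 (pp. 173–176).
* [Milne1986AbelianVarieties] J. S. Milne, *Abelian Varieties*, in Cornell–Silverman (1986), §12 Prop. 12.1 (PDF p. 189).
* [LangeRodriguez2022] H. Lange, R. E. Rodríguez, LNM 2310 (2022), Thm. 2.7.1 (PDF p. 38), §2.9 (PDF p. 44).
-/

noncomputable section

universe u

open CategoryTheory CategoryTheory.Limits

namespace Literature.AlgebraicGeometry.HodgeTheory

namespace AbelianVariety

open _root_.AlgebraicGeometry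
open Literature.AlgebraicGeometry.Motives Literature.AlgebraicGeometry.Motives.AbelianVariety

variable {K : Type u} [Field K]

/-! ## §1 Isogeny decompositions with ∕ without repeated factors -/

section Decompositions

variable {Q : Type} [Fintype Q] {B : Q → Motives.AbelianVariety K} {X : Motives.AbelianVariety K}

/-- **`X ∼ ⨁_q B_q^{m_q}` with a repeated factor (`m_q ≥ 2`, `0 < dim B_q`) has infinitely many abelian subvarieties**
(any field): the block `B_q^{m_q}` is realised by an abelian subvariety `Y_q ↪ X`, which receives a finite `B_q ⊞ B_q`.
[cite: Zarhin2008HomomorphismsFiniteFields, Thm. 3.2 (p. 7)] [cite: MumfordAV1970, §19 Thm. 1 and Cor. 1–2 (pp. 173–174)]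
[cite: LangeRodriguez2022, Thm. 2.7.1 (PDF p. 38)] -/
theorem infinite_setOf_range_subvariety_of_isIsogenous_biproduct_powers {m : Q → ℕ}
    (hX : IsIsogenous X (⨁ fun q ↦ ⨁ fun _ : Fin (m q) ↦ B q)) {q : Q} (hq : 2 ≤ m q) (hB0 : 0 < (B q).dim) :
    {R : Set X.X.left | ∃ (Z : Motives.AbelianVariety K) (j : Z ⟶ X),
        IsClosedImmersion (Hom.toSchemeHom j) ∧ R = Set.range (Hom.toSchemeHom j)}.Infinite := by
  obtain ⟨Y, i, hi, hY, -, -⟩ := exists_isClosedImmersion_isIsogeny_biproduct_desc hX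
  exact infinite_setOf_range_subvariety_of_component i hi (hY q) (k₀ := (⟨0, by omega⟩ : Fin (m q)))
    (k₁ := (⟨1, by omega⟩ : Fin (m q))) (Fin.ne_of_val_ne (by norm_num)) hB0

/-- **`B ⊞ B'` with `B ∼ B'` and `0 < dim B` has infinitely many abelian subvarieties** (any field; e.g. a product of two
isogenous elliptic curves): `𝟙 ⊞ e : B ⊞ B → B ⊞ B'` is finite for an isogeny `e`. [cite: Zarhin2008HomomorphismsFiniteFields, Thm. 3.2 (p. 7)]
[cite: MumfordAV1970, §19 Cor. 1–2 of Thm. 1 (pp. 173–174)] -/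
theorem infinite_setOf_range_subvariety_biprod_of_isIsogenous {B B' : Motives.AbelianVariety K} (h : IsIsogenous B B')
    (hB : 0 < B.dim) :
    {R : Set (B ⊞ B').X.left | ∃ (Z : Motives.AbelianVariety K) (j : Z ⟶ B ⊞ B'),
        IsClosedImmersion (Hom.toSchemeHom j) ∧ R = Set.range (Hom.toSchemeHom j)}.Infinite := by
  obtain ⟨e, he⟩ := h
  haveI : IsFinite (Hom.toSchemeHom e) := he.2
  haveI := isClosedImmersion_toSchemeHom_id B
  haveI := isFinite_toSchemeHom_biprod_map (𝟙 B) e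
  exact infinite_setOf_range_subvariety_of_isFinite_biprod (biprod.map (𝟙 B) e) hB

variable [PerfectField K]

/-- **`X ∼ ⨁_q B_q` with pairwise non-isogenous simple `B_q` of positive dimension has FINITELY MANY abelian subvarieties**
(perfect field): the blocks are realised by simple `Hom`-orthogonal abelian subvarieties `Y_q ↪ X` with `⨁ Y_q → X` an
isogeny, and `…MultiplicityFreeSubvarieties` applies. [cite: Zarhin2008HomomorphismsFiniteFields, Thm. 3.2 (p. 7)]
[cite: MumfordAV1970, §19 Cor. 1–2 of Thm. 1 (pp. 173–174)] [cite: LangeRodriguez2022, Thm. 2.7.1 (PDF p. 38) and §2.9 (PDF p. 44)] -/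
theorem finite_setOf_range_subvariety_of_isIsogenous_biproduct_simple (hB : ∀ q, (B q).IsSimple)
    (hB0 : ∀ q, 0 < (B q).dim) (hni : ∀ q q', q ≠ q' → ¬ IsIsogenous (B q) (B q'))
    (hX : IsIsogenous X (⨁ B)) :
    {R : Set X.X.left | ∃ (Z : Motives.AbelianVariety K) (j : Z ⟶ X),
        IsClosedImmersion (Hom.toSchemeHom j) ∧ R = Set.range (Hom.toSchemeHom j)}.Finite := by
  obtain ⟨Y, i, hi, hY, -, hdesc⟩ := exists_isClosedImmersion_isIsogeny_biproduct_desc hX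
  have h1 : ∀ q, IsIsogenous (B q) (⨁ fun _ : Fin 1 ↦ B q) := fun q ↦
    ⟨(biproductUniqueIso (fun _ : Fin 1 ↦ B q)).inv, isIsogeny_hom_of_iso (biproductUniqueIso _).symm⟩
  have hY' : ∀ q, IsIsogenous (Y q) (⨁ fun _ : Fin (0 + 1) ↦ B q) := fun q ↦ (hY q).trans (h1 q)
  have horth : ∀ q q', q ≠ q' → ∀ f : Y q ⟶ Y q', f = 0 := fun q q' hqq' f ↦
    hom_eq_zero_of_isIsogenous_biproduct_const_of_ne hB hB0 hni hqq' (hY' q) (hY' q') f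
  exact finite_setOf_range_subvariety i hi hdesc horth fun q ↦ (hY q).isSimple_symm (hB q)

/-- … and there are exactly `2^{#Q}` of them. [cite: MumfordAV1970, §19 Cor. 1–2 of Thm. 1 (pp. 173–174)]
[cite: LangeRodriguez2022, §2.9 (PDF p. 44)] [cite: Zarhin2008HomomorphismsFiniteFields, Thm. 3.2 (p. 7)] -/
theorem natCard_setOf_range_subvariety_of_isIsogenous_biproduct_simple (hB : ∀ q, (B q).IsSimple)
    (hB0 : ∀ q, 0 < (B q).dim) (hni : ∀ q q', q ≠ q' → ¬ IsIsogenous (B q) (B q'))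
    (hX : IsIsogenous X (⨁ B)) :
    Nat.card {R : Set X.X.left | ∃ (Z : Motives.AbelianVariety K) (j : Z ⟶ X),
        IsClosedImmersion (Hom.toSchemeHom j) ∧ R = Set.range (Hom.toSchemeHom j)} = 2 ^ Fintype.card Q := by
  obtain ⟨Y, i, hi, hY, hd, hdesc⟩ := exists_isClosedImmersion_isIsogeny_biproduct_desc hX
  have h1 : ∀ q, IsIsogenous (B q) (⨁ fun _ : Fin 1 ↦ B q) := fun q ↦
    ⟨(biproductUniqueIso (fun _ : Fin 1 ↦ B q)).inv, isIsogeny_hom_of_iso (biproductUniqueIso _).symm⟩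
  have hY' : ∀ q, IsIsogenous (Y q) (⨁ fun _ : Fin (0 + 1) ↦ B q) := fun q ↦ (hY q).trans (h1 q)
  have horth : ∀ q q', q ≠ q' → ∀ f : Y q ⟶ Y q', f = 0 := fun q q' hqq' f ↦
    hom_eq_zero_of_isIsogenous_biproduct_const_of_ne hB hB0 hni hqq' (hY' q) (hY' q') f
  exact natCard_setOf_range_subvariety i hi hdesc horth (fun q ↦ (hY q).isSimple_symm (hB q))
    fun q ↦ by rw [hd q]; exact hB0 q

/-- **A simple abelian variety of positive dimension has exactly two abelian subvarieties** (`0` and itself; perfect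
field). [cite: MumfordAV1970, §19 definition p. 174 and Cor. 1 (p. 173)] -/
theorem natCard_setOf_range_subvariety_of_isSimple (hX : X.IsSimple) (hX0 : 0 < X.dim) :
    Nat.card {R : Set X.X.left | ∃ (Z : Motives.AbelianVariety K) (j : Z ⟶ X),
        IsClosedImmersion (Hom.toSchemeHom j) ∧ R = Set.range (Hom.toSchemeHom j)} = 2 := by
  have h := natCard_setOf_range_subvariety_of_isIsogenous_biproduct_simple (Q := Fin 1) (B := fun _ ↦ X)
    (fun _ ↦ hX) (fun _ ↦ hX0) (fun q q' hqq' _ ↦ hqq' (Subsingleton.elim q q'))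
    ⟨(biproductUniqueIso (fun _ : Fin 1 ↦ X)).inv, isIsogeny_hom_of_iso (biproductUniqueIso _).symm⟩
  rwa [Fintype.card_fin, pow_one] at h

end Decompositions

/-! ## §2 The characterisation over a perfect field -/

section Criterion

variable [PerfectField K] (X : Motives.AbelianVariety K)

/-- **AN ABELIAN VARIETY HAS FINITELY MANY ABELIAN SUBVARIETIES IFF IT IS ISOGENOUS TO A PRODUCT OF PAIRWISE NON-ISOGENOUS
SIMPLE ABELIAN VARIETIES** (perfect field; abelian subvarieties recorded by their closed subsets).  (`⟹`: take isotypic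
components `Y_q ∼ B_q^{n_q+1}`; finiteness forces every `n_q = 0`, so `X ∼ ⨁ Y_q ∼ ⨁ B_q`; `⟸`: §1.)
[cite: Zarhin2008HomomorphismsFiniteFields, Thm. 3.2 (p. 7) (Lenstra–Oort–Zarhin 1996)] [cite: MumfordAV1970, §19 Cor. 1–2 of Thm. 1 (pp. 173–174)]
[cite: Milne1986AbelianVarieties, §12 Prop. 12.1 (PDF p. 189)] -/
theorem finite_setOf_range_subvariety_iff_exists_isIsogenous_biproduct_simple :
    {R : Set X.X.left | ∃ (Z : Motives.AbelianVariety K) (j : Z ⟶ X),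
        IsClosedImmersion (Hom.toSchemeHom j) ∧ R = Set.range (Hom.toSchemeHom j)}.Finite ↔
      ∃ (r : ℕ) (B : Fin r → Motives.AbelianVariety K), (∀ q, (B q).IsSimple) ∧ (∀ q, 0 < (B q).dim) ∧
        (∀ q q', q ≠ q' → ¬ IsIsogenous (B q) (B q')) ∧ IsIsogenous X (⨁ B) := by
  constructor
  · intro hfin
    obtain ⟨r, B, n, Y, i, hB, hB0, hni, hi, hY, -, hdesc, -⟩ := exists_isotypicComponents_orthogonal X
    have h0 : ∀ q, n q = 0 :=
      (finite_setOf_range_subvariety_iff_forall_multiplicity_eq_zero hB hB0 hni hY i hi hdesc).1 hfin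
    refine ⟨r, B, hB, hB0, hni, ?_⟩
    have hYB : ∀ q, IsIsogenous (Y q) (B q) := fun q ↦ by
      have hd : (Y q).dim = (B q).dim := by
        rw [dim_eq_mul_of_isIsogenous_biproduct_const (hY q), h0 q, zero_add, one_mul]
      exact isIsogenous_of_isIsogenous_biproduct_const_of_dim_le (hY q) (by rw [hd]; exact hB0 q) hd.le
    exact (IsIsogenous.symm' ⟨biproduct.desc i, hdesc⟩).trans (IsIsogenous.biproduct hYB)
  · rintro ⟨r, B, hB, hB0, hni, hX⟩
    exact finite_setOf_range_subvariety_of_isIsogenous_biproduct_simple hB hB0 hni hX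

end Criterion

end AbelianVariety

end Literature.AlgebraicGeometry.HodgeTheory

end
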